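import Mathlib
import Summits.Ventures.PercRepro2.Defs
import Summits.Ventures.PercRepro2.Independence
import Summits.Ventures.PercRepro2.Graph
import Summits.Ventures.PercRepro2.Switching
import Summits.Ventures.PercRepro2.LastVertex
import Summits.Ventures.PercRepro2.ReimerIncreasing
import Summits.Ventures.PercRepro2.ReimerDecreasing
import Summits.Ventures.PercRepro2.TwoClusterBK
import Summits.Ventures.PercRepro2.HullDefs

/-!
# The one-sided (BASE): two-cluster Reimer in counting form on the free fibre
(blind cell PercRepro2, mine-2 g10; `proofs/MINE2-CUTVERTEX.md` §8.4)

On the free fibre (uniform 2-colouring, blue = `Hull.blue ζ`) the cross-cluster inequality of (BASE)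
holds with the blue avoidance `h ∉ C_B(u)` DROPPED, by Reimer's inequality restricted to a decreasing
event (mine-1's `ReimerCube.reimer_decreasing`):

* `half_nonneg`:  `#{h ∉ C_R(u), o ∈ C_R(u), b ∈ C_R(h)} ≤ #{h ∉ C_R(u), o ∈ C_R(u), b ∈ C_B(h)}`
  — the functional `Half(G; u; o, b) = Σ_{h ∉ RU} 1[o ∈ RU] s′_{b,h}` of the series–parallel
  theorem is nonnegative;
* `half_edge_nonneg`: the same with an extra red edge `g` at `u` required on both sides
  (the term `S(u, g)` / `Half(· | g red)` of the degree-2 root reduction);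
* `ta_nonneg`: `#{g red, h ∈ C_B(u) ∖ C_R(u), b ∈ C_R(h)} ≤ #{g red, h ∈ C_B(u) ∖ C_R(u), b ∈ C_B(h)}`
  (the term `T_a` of the root-edge case; decreasing event `{h ∉ C_R(u)} ∩ {h ∈ C_B(u)}`).

Mechanism (`count_le`): on the left the red witnesses — the `u`-component of the red set for the
first event, the `h`-component for `b ↔_R h` — lie in different red clusters (`h ∉ C_R(u)`), so they
are disjoint (`disjoint_sComp_of_not_carries`) and the left side is a disjoint occurrence; Reimer
restricted to the decreasing event bounds it by the count with the second event evaluated on the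
complementary (blue) set. The bridge `Config E ≃ Finset E` (`toFinset` / `ofFinset`) transports the
counting statement to the cell's configuration vocabulary (`card_filter_eq_card_powerset_filter`).
-/

namespace Summit.Ventures.PercRepro2

namespace OneSided

open ReimerCube

variable {V : Type*} {E : Type*} [DecidableEq E]

/-! ## Reimer on the cube for a first event with a witness inside the `u`-component -/

/-- `Carries · h b` is increasing. -/
lemma incr_carries (ends : E → Sym2 V) (h b : V) : Incr (fun T : Finset E => Carries ends T h b) :=
  fun _ _ hST hS => hS.mono hST

/-- `¬ Carries · u h` is decreasing. -/
lemma decr_not_carries (ends : E → Sym2 V) (u h : V) :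
    Decr (fun S : Finset E => ¬ Carries ends S u h) :=
  fun _ _ hST hT hS => hT (hS.mono hST)

variable [Fintype E]

/-- `Carries (univ \ ·) u h` is decreasing in the red set. -/
lemma decr_carries_compl (ends : E → Sym2 V) (u h : V) :
    Decr (fun S : Finset E => Carries ends (Finset.univ \ S) u h) :=
  fun _ _ hST hT => hT.mono (Finset.sdiff_subset_sdiff le_rfl hST)

open Classical in
/-- **Two-cluster Reimer, counting form.** For an increasing event `A` whose occurrence at `S` is
witnessed inside the `u`-component of `S`, and a decreasing `D ⊆ {u ↮ h}`:
`#{A, h ↔_R b, D} ≤ #{A, h ↔_B b, D}` (red = the set `S`, blue = its complement). -/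
theorem count_le (ends : E → Sym2 V) (u h b : V) (A D : Finset E → Prop) (hA : Incr A)
    (hD : Decr D) (hDuh : ∀ S, D S → ¬ Carries ends S u h)
    (hwit : ∀ S, A S → ∃ K, K ⊆ sComp ends S u ∧ ∀ T, K ⊆ T → A T) :
    (Finset.univ.powerset.filter fun S : Finset E => A S ∧ Carries ends S h b ∧ D S).card ≤
      (Finset.univ.powerset.filter fun S : Finset E =>
        A S ∧ Carries ends (Finset.univ \ S) h b ∧ D S).card := by
  calc (Finset.univ.powerset.filter fun S : Finset E => A S ∧ Carries ends S h b ∧ D S).card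
      ≤ (Finset.univ.powerset.filter fun S : Finset E =>
          DOcc A (fun T => Carries ends T h b) S ∧ D S).card := by
        apply Finset.card_le_card
        intro S hS
        simp only [Finset.mem_filter, Finset.mem_powerset] at hS ⊢
        obtain ⟨hSU, hAS, hhb, hDS⟩ := hS
        refine ⟨hSU, ?_, hDS⟩
        obtain ⟨K, hK, hKA⟩ := hwit S hAS
        refine ⟨K, sComp ends S h, hK.trans (sComp_subset ends S u), sComp_subset ends S h, ?_,
          hKA, fun T hT => (carries_sComp hhb).mono hT⟩
        exact Finset.disjoint_of_subset_left hK (disjoint_sComp_of_not_carries (hDuh S hDS))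
    _ ≤ _ := reimer_decreasing Finset.univ A (fun T => Carries ends T h b) D hA
          (incr_carries ends h b) hD

/-! ## The bridge `Config E ↔ Finset E` -/

/-- The red set of a configuration. -/
def toFinset (ζ : Config E) : Finset E := Finset.univ.filter fun e => ζ e = true

/-- `ofFinset ∘ toFinset = id`. -/
lemma ofFinset_toFinset (ζ : Config E) : ofFinset (toFinset ζ) = ζ := by
  funext e
  simp only [ofFinset_apply, toFinset, Finset.mem_filter, Finset.mem_univ, true_and]
  cases ζ e <;> simp

/-- `toFinset ∘ ofFinset = id`. -/
lemma toFinset_ofFinset (S : Finset E) : toFinset (ofFinset S) = S := by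
  ext e
  simp [toFinset, ofFinset]

/-- The complementary set is the blue configuration. -/
lemma ofFinset_sdiff (S : Finset E) : ofFinset (Finset.univ \ S) = Hull.blue (ofFinset S) := by
  funext e
  simp only [ofFinset_apply, Hull.blue_apply, Finset.mem_sdiff, Finset.mem_univ, true_and]
  by_cases h : e ∈ S <;> simp [h]

/-- Counting configurations is counting red sets. -/
lemma card_filter_eq_card_powerset_filter (P : Config E → Prop) [DecidablePred P]
    [DecidablePred fun S : Finset E => P (ofFinset S)] :
    (Finset.univ.filter fun ζ : Config E => P ζ).card =
      (Finset.univ.powerset.filter fun S : Finset E => P (ofFinset S)).card := by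
  refine Finset.card_nbij' toFinset ofFinset ?_ ?_ ?_ ?_
  · intro ζ hζ
    simp only [Finset.coe_filter, Finset.mem_univ, true_and, Set.mem_setOf_eq,
      Finset.mem_powerset, Finset.subset_univ] at hζ ⊢
    rw [ofFinset_toFinset]; exact hζ
  · intro S hS
    simp only [Finset.coe_filter, Finset.mem_univ, true_and, Set.mem_setOf_eq,
      Finset.mem_powerset] at hS ⊢
    exact hS.2
  · intro ζ _; exact ofFinset_toFinset ζ
  · intro S _; exact toFinset_ofFinset S

/-! ## The configuration-level statements -/

open Classical in
/-- **The one-sided (BASE) / `Half ≥ 0`**: on the free fibre,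
`#{h ∉ C_R(u), o ∈ C_R(u), b ∈ C_R(h)} ≤ #{h ∉ C_R(u), o ∈ C_R(u), b ∈ C_B(h)}`. -/
theorem half_nonneg (ends : E → Sym2 V) (u h o b : V) :
    (Finset.univ.filter fun ζ : Config E =>
        h ∉ cluster ends ζ u ∧ o ∈ cluster ends ζ u ∧ b ∈ cluster ends ζ h).card ≤
      (Finset.univ.filter fun ζ : Config E =>
        h ∉ cluster ends ζ u ∧ o ∈ cluster ends ζ u ∧ b ∈ cluster ends (Hull.blue ζ) h).card := by
  rw [card_filter_eq_card_powerset_filter, card_filter_eq_card_powerset_filter]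
  have key := count_le ends u h b (fun S => Carries ends S u o) (fun S => ¬ Carries ends S u h)
    (fun _ _ hST hS => hS.mono hST) (decr_not_carries ends u h) (fun _ hS => hS)
    (fun S hS => ⟨sComp ends S u, le_rfl, fun T hT => (carries_sComp hS).mono hT⟩)
  refine le_of_le_of_eq (le_of_eq_of_le ?_ key) ?_
  · congr 1; ext S
    simp only [Finset.mem_filter, Finset.mem_powerset, mem_cluster, Carries]; tauto
  · congr 1; ext S
    simp only [Finset.mem_filter, Finset.mem_powerset, mem_cluster, Carries, ofFinset_sdiff]; tauto

open Classical in
/-- `Half ≥ 0` with a red edge `g` at `u` required on both sides: the term `S(u, g)` of the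
degree-2 root reduction. -/
theorem half_edge_nonneg (ends : E → Sym2 V) (u h o b : V) (g : E) (hg : u ∈ ends g) :
    (Finset.univ.filter fun ζ : Config E =>
        ζ g = true ∧ h ∉ cluster ends ζ u ∧ o ∈ cluster ends ζ u ∧ b ∈ cluster ends ζ h).card ≤
      (Finset.univ.filter fun ζ : Config E =>
        ζ g = true ∧ h ∉ cluster ends ζ u ∧ o ∈ cluster ends ζ u ∧
          b ∈ cluster ends (Hull.blue ζ) h).card := by
  rw [card_filter_eq_card_powerset_filter, card_filter_eq_card_powerset_filter]
  have key := count_le ends u h b (fun S => g ∈ S ∧ Carries ends S u o)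
    (fun S => ¬ Carries ends S u h)
    (fun _ _ hST hS => ⟨hST hS.1, hS.2.mono hST⟩) (decr_not_carries ends u h) (fun _ hS => hS)
    (fun S hS => ⟨sComp ends S u, le_rfl, fun T hT =>
      ⟨hT (by rw [sComp, Finset.mem_filter]; exact ⟨hS.1, u, hg, conn_refl _ _ _⟩),
        (carries_sComp hS.2).mono hT⟩⟩)
  refine le_of_le_of_eq (le_of_eq_of_le ?_ key) ?_
  · congr 1; ext S
    simp only [Finset.mem_filter, Finset.mem_powerset, mem_cluster, Carries, ofFinset_apply,
      decide_eq_true_eq]; tauto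
  · congr 1; ext S
    simp only [Finset.mem_filter, Finset.mem_powerset, mem_cluster, Carries, ofFinset_apply,
      decide_eq_true_eq, ofFinset_sdiff]; tauto

open Classical in
/-- **The term `T_a` of the root-edge case**: for an edge `g` at `u`,
`#{g red, h ∈ C_B(u) ∖ C_R(u), b ∈ C_R(h)} ≤ #{g red, h ∈ C_B(u) ∖ C_R(u), b ∈ C_B(h)}`. -/
theorem ta_nonneg (ends : E → Sym2 V) (u h b : V) (g : E) (hg : u ∈ ends g) :
    (Finset.univ.filter fun ζ : Config E =>
        ζ g = true ∧ (h ∉ cluster ends ζ u ∧ h ∈ cluster ends (Hull.blue ζ) u) ∧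
          b ∈ cluster ends ζ h).card ≤
      (Finset.univ.filter fun ζ : Config E =>
        ζ g = true ∧ (h ∉ cluster ends ζ u ∧ h ∈ cluster ends (Hull.blue ζ) u) ∧
          b ∈ cluster ends (Hull.blue ζ) h).card := by
  rw [card_filter_eq_card_powerset_filter, card_filter_eq_card_powerset_filter]
  have key := count_le ends u h b (fun S => g ∈ S)
    (fun S => ¬ Carries ends S u h ∧ Carries ends (Finset.univ \ S) u h)
    (fun _ _ hST hS => hST hS)
    (fun _ _ hST hT => ⟨decr_not_carries ends u h hST hT.1, decr_carries_compl ends u h hST hT.2⟩)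
    (fun _ hS => hS.1)
    (fun S hS => ⟨{g}, by
      rw [Finset.singleton_subset_iff, sComp, Finset.mem_filter]
      exact ⟨hS, u, hg, conn_refl _ _ _⟩, fun T hT => hT (Finset.mem_singleton_self g)⟩)
  refine le_of_le_of_eq (le_of_eq_of_le ?_ key) ?_
  · congr 1; ext S
    simp only [Finset.mem_filter, Finset.mem_powerset, mem_cluster, Carries, ofFinset_apply,
      decide_eq_true_eq, ofFinset_sdiff]; tauto
  · congr 1; ext S
    simp only [Finset.mem_filter, Finset.mem_powerset, mem_cluster, Carries, ofFinset_apply,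
      decide_eq_true_eq, ofFinset_sdiff]; tauto

end OneSided

end Summit.Ventures.PercRepro2
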